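import Summits.QuantumFields.BalabanUV.Beta.GAN24.AffineUnroll

/-!
# `BalabanUV.Beta.GAN24.TransportTelescope` — binder row G-an2-4 ∕ (CONV-C), CT-W (the row owner's «CT-W DESIGN v0», RULING R-gan24p1-g22-1, route
# (R-HYB)+(R-CT)): THE TWO-FAMILY DUHAMEL IDENTITY — the difference of the composite transports of two families of maps is the sum over levels of
# «transport by the first family ∘ (one-level map difference) ∘ transport by the second family», and the HYBRID SPLIT of two affine towers with the
# same sources

NOT IN PRINT; OUR BOOKKEEPING (G-an2-4 formalisation swarm, leaf prover `b2b-balaban-gan24-formalise-leaf-06`, gen 42; journal OFFER O-leaf06g42-2 l.37170; the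
generic algebra half of the row owner's CT-W1; module name PROVISIONAL — the row owner gan24-p1 may rename ∕ re-home it).  HONEST FRAMING (cell contract,
verbatim): «discharging `BetaPertH` makes Bałaban's UV stability UNCONDITIONAL — a real constructive-QFT result; it is NOT the continuum limit and NOT the
Clay problem.»  HONEST DEPENDENCY (verbatim): «continuum YM on T⁴ ⇐ BetaPertH ∧ nine spine estimates (0/9 proved); BetaPertH ⇐ (D1) ∧ (D4) ∧ CAP+tail;
G-an2-4 gates asym, D1 and NE2/3/4.»

WHY.  The route of record splits the DRESSED normalised `T₂` tower `T^E_{n+1} = 𝒜^E_n T^E_n + b^E_n` against the HYBRID tower `T^H_{n+1} = 𝒜^B_n T^H_n + b^E_n`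
(UNDRESSED maps `𝒜^B_j = lin4 c K♮_j Lc`, the SAME dressed sources; `CT-W-DESIGN-v0.md` §2 (R-HYB)): `T^E_n = T^H_n + CONTACT_{W,n}`,
`CONTACT_{W,n} = [P^E − P^B](0,n) T_0 + Σ_{i<n} [P^E − P^B](i+1, n−1−i) b^E_i`, and (R-CT) analyses `P^E − P^B` one level ∕ one leg at a time.  With PART 1∕2
(`GAN24/LinT2CoDressed(Step)`: `𝒜^E_j = 𝒜^B_j ∘ 𝔇`) every one-level map difference is `𝒜^B_j ∘ (𝔇 − 1)`.  THIS FILE is the `K`-free, `lin4`-free ALGEBRA of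
that split in leaf-01's `AffineUnroll` framework (maps additive ONLY on a class `P` closed under `+`, `−`, containing `0`, preserved by both families).

WHAT ([folklore] additive-group algebra over leaf-01's `AffineUnroll.transport` BY NAME; 0 `def`, 0 cite, 0 `def … : Prop`, 0 sorry):
* §1 **`transport_sub_transport`**: for `x ∈ P`,
  `transport A m k x − transport B m k x = Σ_{i ∈ range k} transport A (m+i+1) (k−1−i) (A (m+i) (transport B m i x) − B (m+i) (transport B m i x))`
  (left factors by the FIRST family, right factors by the SECOND; the mirror form `transport_sub_transport'` has them exchanged).
* §2 **`hybrid_split`**: two affine towers with the SAME sources and the SAME initial datum, `x (j+1) = A j (x j) + b j`, `y (j+1) = B j (y j) + b j`, `x 0 = y 0`,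
  differ by `x n − y n = (transport A 0 n (x 0) − transport B 0 n (x 0)) + Σ_{m ∈ range n} (transport A (m+1) (n−1−m) (b m) − transport B (m+1) (n−1−m) (b m))`
  — the row owner's `CONTACT_{W,n}` as a theorem (leaf-01's `eq_transport_add_sum` twice).
Pure algebra: no estimate, no rate, no constant; asserts NOTHING about an2's tables; discharges NOTHING of «T2Shape» ∕ «T2Drift» ∕ (hW, hWall); 0 wall binders;
NEVER «G-an2-4 closed» as (CONV-C); NOT D1, NOT `BetaPertH`, NOT continuum, NOT Clay; not in print — our bookkeeping.  Unit `b2b-balaban-gan24-formalise-leaf-06`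
(gen 42), 2026-08-21.
-/

open Finset
open scoped BigOperators

namespace Summit.QuantumFields.BalabanUV.Beta.GAN24.TransportTelescope

open Summit.QuantumFields.BalabanUV.Beta.GAN24.AffineUnroll (transport transport_zero transport_succ transport_mem map_sub_of_add map_sum_of_add
  eq_transport_add_sum)

variable {E : Type*} [AddCommGroup E] {A B : ℕ → E → E} {P : E → Prop}

/-! ## §1 The two-family Duhamel identity -/

/-- [folklore] **THE TWO-FAMILY DUHAMEL IDENTITY.**  For two families of maps `A B : ℕ → E → E` preserving a class `P ∋ 0` closed under `+` and `−`, with the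
FIRST family additive on `P`, and `x ∈ P`:
`transport A m k x − transport B m k x = Σ_{i ∈ range k} transport A (m+i+1) (k−1−i) (A (m+i) (transport B m i x) − B (m+i) (transport B m i x))` —
the `k`-step composite of `A` minus that of `B` is the sum over the level `m+i` at which the two families are compared, of «`B` up to that level, the one-level
difference there, `A` above it». -/
theorem transport_sub_transport (hP0 : P 0) (hPadd : ∀ x y, P x → P y → P (x + y)) (hPsub : ∀ x y, P x → P y → P (x - y))
    (hAP : ∀ j x, P x → P (A j x)) (hBP : ∀ j x, P x → P (B j x)) (hAadd : ∀ j x y, P x → P y → A j (x + y) = A j x + A j y)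
    (m k : ℕ) {x : E} (hx : P x) :
    transport A m k x - transport B m k x
      = ∑ i ∈ Finset.range k, transport A (m + i + 1) (k - 1 - i) (A (m + i) (transport B m i x) - B (m + i) (transport B m i x)) := by
  induction k with
  | zero => simp
  | succ k ih =>
    -- the one-level differences are in the class
    have hd : ∀ i, P (A (m + i) (transport B m i x) - B (m + i) (transport B m i x)) := fun i =>
      hPsub _ _ (hAP _ _ (transport_mem hBP m i hx)) (hBP _ _ (transport_mem hBP m i hx))
    have hTA : P (transport A m k x) := transport_mem hAP m k hx
    have hTB : P (transport B m k x) := transport_mem hBP m k hx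
    -- peel the top level and split `A (T^A x) − B (T^B x) = A (T^A x − T^B x) + (A − B)(T^B x)`
    have e1 : transport A m (k + 1) x - transport B m (k + 1) x
        = A (m + k) (transport A m k x - transport B m k x)
          + (A (m + k) (transport B m k x) - B (m + k) (transport B m k x)) := by
      rw [transport_succ, transport_succ, map_sub_of_add hPsub (hAadd (m + k)) hTA hTB]
      abel
    rw [e1, ih, map_sum_of_add hP0 hPadd (hAadd (m + k)) _ _ (fun i _ => transport_mem hAP _ _ (hd i)), Finset.sum_range_succ]
    congr 1
    · refine Finset.sum_congr rfl fun i hi => ?_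
      have hik : i < k := Finset.mem_range.1 hi
      have e2 : k + 1 - 1 - i = (k - 1 - i) + 1 := by omega
      rw [e2, transport_succ]
      congr 1
      omega
    · have e3 : k + 1 - 1 - k = 0 := by omega
      rw [e3, transport_zero]

/-- [folklore] **THE MIRROR FORM** (left factors by the SECOND family, right factors by the FIRST; the second family additive on `P`):
`transport A m k x − transport B m k x = Σ_{i ∈ range k} transport B (m+i+1) (k−1−i) (A (m+i) (transport A m i x) − B (m+i) (transport A m i x))`. -/
theorem transport_sub_transport' (hP0 : P 0) (hPadd : ∀ x y, P x → P y → P (x + y)) (hPsub : ∀ x y, P x → P y → P (x - y))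
    (hAP : ∀ j x, P x → P (A j x)) (hBP : ∀ j x, P x → P (B j x)) (hBadd : ∀ j x y, P x → P y → B j (x + y) = B j x + B j y)
    (m k : ℕ) {x : E} (hx : P x) :
    transport A m k x - transport B m k x
      = ∑ i ∈ Finset.range k, transport B (m + i + 1) (k - 1 - i) (A (m + i) (transport A m i x) - B (m + i) (transport A m i x)) := by
  have h := transport_sub_transport (A := B) (B := A) hP0 hPadd hPsub hBP hAP hBadd m k hx
  -- `T^B − T^A = Σ T^B ∘ (B − A) ∘ T^A`; negate
  have e : ∀ i, B (m + i) (transport A m i x) - A (m + i) (transport A m i x)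
      = -(A (m + i) (transport A m i x) - B (m + i) (transport A m i x)) := fun i => by abel
  have hd : ∀ i, P (A (m + i) (transport A m i x) - B (m + i) (transport A m i x)) := fun i =>
    hPsub _ _ (hAP _ _ (transport_mem hAP m i hx)) (hBP _ _ (transport_mem hAP m i hx))
  have hneg : ∀ (j l : ℕ) (y : E), P y → transport B j l (-y) = -transport B j l y := by
    intro j l y hy
    have h0 : transport B j l (0 : E) = 0 := AffineUnroll.transport_map_zero hP0 hBadd j l
    have hs := AffineUnroll.transport_sub hPsub hBP hBadd j l hP0 hy
    rw [zero_sub, h0, zero_sub] at hs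
    exact hs
  rw [← neg_sub, h, ← Finset.sum_neg_distrib]
  refine Finset.sum_congr rfl fun i _ => ?_
  rw [e i, hneg _ _ _ (hd i), neg_neg]

/-! ## §2 The hybrid split of two affine towers with the same sources -/

/-- [folklore] **THE HYBRID SPLIT** (the row owner's `CONTACT_{W,n}` as a theorem).  Two affine towers in the class with the SAME sources and the SAME initial datum,
`x (j+1) = A j (x j) + b j` and `y (j+1) = B j (y j) + b j`, `y 0 = x 0`, differ by the transport differences ALONE:
`x n − y n = (transport A 0 n (x 0) − transport B 0 n (x 0)) + Σ_{m ∈ range n} (transport A (m+1) (n−1−m) (b m) − transport B (m+1) (n−1−m) (b m))`. -/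
theorem hybrid_split (hP0 : P 0) (hPadd : ∀ x y, P x → P y → P (x + y))
    (hAP : ∀ j x, P x → P (A j x)) (hBP : ∀ j x, P x → P (B j x))
    (hAadd : ∀ j x y, P x → P y → A j (x + y) = A j x + A j y) (hBadd : ∀ j x y, P x → P y → B j (x + y) = B j x + B j y)
    {x y b : ℕ → E} (hx0 : P (x 0)) (hb : ∀ j, P (b j)) (hxrec : ∀ j, x (j + 1) = A j (x j) + b j) (hyrec : ∀ j, y (j + 1) = B j (y j) + b j)
    (hy0 : y 0 = x 0) (n : ℕ) :
    x n - y n = (transport A 0 n (x 0) - transport B 0 n (x 0))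
      + ∑ m ∈ Finset.range n, (transport A (m + 1) (n - 1 - m) (b m) - transport B (m + 1) (n - 1 - m) (b m)) := by
  have hy0' : P (y 0) := by rw [hy0]; exact hx0
  rw [eq_transport_add_sum hP0 hPadd hAP hAadd hx0 hb hxrec n, eq_transport_add_sum hP0 hPadd hBP hBadd hy0' hb hyrec n, hy0,
    Finset.sum_sub_distrib]
  abel

/-- [folklore] **THE HYBRID SPLIT, ONE LEVEL AT A TIME**: combining `hybrid_split` with `transport_sub_transport`, the tower difference is a double sum of
«`A`-transport above ∘ (one-level map difference) ∘ `B`-transport below» acting on the initial datum and on each source. -/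
theorem hybrid_split_levels (hP0 : P 0) (hPadd : ∀ x y, P x → P y → P (x + y)) (hPsub : ∀ x y, P x → P y → P (x - y))
    (hAP : ∀ j x, P x → P (A j x)) (hBP : ∀ j x, P x → P (B j x))
    (hAadd : ∀ j x y, P x → P y → A j (x + y) = A j x + A j y) (hBadd : ∀ j x y, P x → P y → B j (x + y) = B j x + B j y)
    {x y b : ℕ → E} (hx0 : P (x 0)) (hb : ∀ j, P (b j)) (hxrec : ∀ j, x (j + 1) = A j (x j) + b j) (hyrec : ∀ j, y (j + 1) = B j (y j) + b j)
    (hy0 : y 0 = x 0) (n : ℕ) :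
    x n - y n
      = (∑ i ∈ Finset.range n, transport A (i + 1) (n - 1 - i) (A i (transport B 0 i (x 0)) - B i (transport B 0 i (x 0))))
        + ∑ m ∈ Finset.range n, ∑ i ∈ Finset.range (n - 1 - m),
            transport A (m + 1 + i + 1) (n - 1 - m - 1 - i)
              (A (m + 1 + i) (transport B (m + 1) i (b m)) - B (m + 1 + i) (transport B (m + 1) i (b m))) := by
  rw [hybrid_split hP0 hPadd hAP hBP hAadd hBadd hx0 hb hxrec hyrec hy0 n, transport_sub_transport hP0 hPadd hPsub hAP hBP hAadd 0 n hx0]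
  simp only [Nat.zero_add]
  congr 1
  exact Finset.sum_congr rfl fun m _ => transport_sub_transport hP0 hPadd hPsub hAP hBP hAadd (m + 1) (n - 1 - m) (hb m)

end Summit.QuantumFields.BalabanUV.Beta.GAN24.TransportTelescope
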